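import Literature.Geometry.Lorentzian.LandauLifshitzSuperpotentialVariation
import HarnessLib

/-!
# The Landau–Lifshitz energy–momentum complex along a `C²` field, through the value jets

For a field of components `g : E4 → (E4 →L[ℝ] E4 →L[ℝ] ℝ)` that is `C²` at `x` and nondegenerate
at `x`, the superpotential `H^{μανβ}(y)` factors through the value, `H(y) = Φ(g y)` with
`Φ A = superpotential (fun _ ↦ A) 0 …` (`LandauLifshitzSuperpotentialVariation.lean`), so the
second-order chain rule gives

  `∂_δ ∂_γ H(x) = D²Φ(g x)(∂_δ g, ∂_γ g) + DΦ(g x)(∂_δ∂_γ g)`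

(`fderiv_partialDeriv_superpotential_apply`), and hence the Landau–Lifshitz complex
`Σ_α ∂_α h^{μνα} = (16π)⁻¹ Σ_{αβ} ∂_α∂_β H^{μβνα}` (LL (96.2), (96.5)) splits into a part that is
QUADRATIC in the first derivatives of `g` and a part that is LINEAR in the second derivatives
(`emComplex_eq_sum_jet`). This is the analytic half of LL's statement that `(−g) t^{μν}_LL` is a
quadratic form in `∂g` ((96.8)/(96.9)); the algebraic half (cancellation of the second
derivatives against `(−g) G^{μν}/8π`) is separate.

## References
* L. D. Landau, E. M. Lifshitz, *The Classical Theory of Fields*, 4th ed., Pergamon 1975, §96,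
  (96.2)–(96.5). [LandauLifshitz1975]
-/

noncomputable section

set_option maxSynthPendingDepth 3

open Filter Set
open scoped Topology ContDiff Matrix

namespace Literature.Geometry.Lorentzian

namespace LandauLifshitz
section AlongField

variable {g : E4 → E4 →L[ℝ] E4 →L[ℝ] ℝ} {x : E4}

/-- Nondegeneracy propagates from `x` to a neighbourhood along a field continuous at `x`.
[folklore] -/
theorem eventually_metricDet_ne_zero (hg : ContinuousAt g x) (hx : metricDet g x ≠ 0) :
    ∀ᶠ y in 𝓝 x, metricDet g y ≠ 0 := by
  have hc : ContinuousAt (fun y ↦ metricDet (fun _ : E4 ↦ g y) 0) x :=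
    (contDiff_metricDet_const (n := 0)).continuous.continuousAt.comp hg
  exact hc.eventually_ne hx

/-- First-order chain rule: `D(H^{μανβ} ∘ g)(y) = DH(g y) ∘ Dg(y)` at a point where `g` is
differentiable and nondegenerate. [cite: LandauLifshitz1975, §96 (96.3)] -/
theorem hasFDerivAt_superpotential {y : E4} (hg : DifferentiableAt ℝ g y) (hy : metricDet g y ≠ 0)
    (μ α ν β : Fin 4) :
    HasFDerivAt (fun z ↦ superpotential g z μ α ν β)
      ((fderiv ℝ (fun A : E4 →L[ℝ] E4 →L[ℝ] ℝ ↦ superpotential (fun _ : E4 ↦ A) 0 μ α ν β) (g y)).comp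
        (fderiv ℝ g y)) y :=
  (differentiableAt_superpotential_const hy μ α ν β).hasFDerivAt.comp y hg.hasFDerivAt

/-- The coordinate derivative `∂_β H^{μανβ}` through the value derivative, at a point where `g` is
differentiable and nondegenerate. [cite: LandauLifshitz1975, §96 (96.2)] -/
theorem partialDeriv_superpotential_eq {y : E4} (hg : DifferentiableAt ℝ g y)
    (hy : metricDet g y ≠ 0) (γ μ α ν β : Fin 4) :
    partialDeriv γ (fun z ↦ superpotential g z μ α ν β) y =
      fderiv ℝ (fun A : E4 →L[ℝ] E4 →L[ℝ] ℝ ↦ superpotential (fun _ : E4 ↦ A) 0 μ α ν β) (g y)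
        (fderiv ℝ g y (E4.basisVector γ)) := by
  rw [partialDeriv, (hasFDerivAt_superpotential hg hy μ α ν β).fderiv]
  rfl

/-- **Second-order chain rule for the superpotential along a `C²` field**: the map
`y ↦ ∂_γ H^{μανβ}(y)` is differentiable at `x` with derivative
`v ↦ DH(g x)(D²g(x)(v, ∂_γ)) + D²H(g x)(Dg(x) v, Dg(x) ∂_γ)`. [cite: LandauLifshitz1975, §96 (96.2)] -/
theorem hasFDerivAt_partialDeriv_superpotential (hg : ContDiffAt ℝ 2 g x) (hx : metricDet g x ≠ 0)
    (γ μ α ν β : Fin 4) :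
    HasFDerivAt (fun y ↦ partialDeriv γ (fun z ↦ superpotential g z μ α ν β) y)
      ((fderiv ℝ (fun A : E4 →L[ℝ] E4 →L[ℝ] ℝ ↦ superpotential (fun _ : E4 ↦ A) 0 μ α ν β) (g x)).comp
          ((fderiv ℝ (fderiv ℝ g) x).flip (E4.basisVector γ)) +
        ((fderiv ℝ (fderiv ℝ (fun A : E4 →L[ℝ] E4 →L[ℝ] ℝ ↦ superpotential (fun _ : E4 ↦ A) 0 μ α ν β))
            (g x)).comp (fderiv ℝ g x)).flip (fderiv ℝ g x (E4.basisVector γ))) x := by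
  set Φ : (E4 →L[ℝ] E4 →L[ℝ] ℝ) → ℝ :=
    fun A ↦ superpotential (fun _ : E4 ↦ A) 0 μ α ν β with hΦ
  -- `g` is `C²`, hence differentiable, near `x`; nondegeneracy persists near `x`
  have hdiff : ∀ᶠ y in 𝓝 x, DifferentiableAt ℝ g y := by
    filter_upwards [hg.eventually (by simp)] with y hy
    exact hy.differentiableAt (by simp)
  have hdet : ∀ᶠ y in 𝓝 x, metricDet g y ≠ 0 :=
    eventually_metricDet_ne_zero hg.continuousAt hx
  -- near `x` the function is `y ↦ DΦ(g y) (Dg(y) ∂_γ)`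
  have heq : (fun y ↦ partialDeriv γ (fun z ↦ superpotential g z μ α ν β) y) =ᶠ[𝓝 x]
      fun y ↦ (fderiv ℝ Φ (g y)) (fderiv ℝ g y (E4.basisVector γ)) := by
    filter_upwards [hdiff, hdet] with y hy hy'
    exact partialDeriv_superpotential_eq hy hy' γ μ α ν β
  -- derivative of `y ↦ DΦ(g y)`
  have hΦ2 : ContDiffAt ℝ 2 Φ (g x) := contDiffAt_superpotential_const hx μ α ν β
  have hL : HasFDerivAt (fun y ↦ fderiv ℝ Φ (g y))
      ((fderiv ℝ (fderiv ℝ Φ) (g x)).comp (fderiv ℝ g x)) x := by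
    have h1 : DifferentiableAt ℝ (fderiv ℝ Φ) (g x) :=
      (hΦ2.fderiv_right (m := 1) le_rfl).differentiableAt one_ne_zero
    exact h1.hasFDerivAt.comp x (hg.differentiableAt (by simp)).hasFDerivAt
  -- derivative of `y ↦ Dg(y) ∂_γ`
  have hw : HasFDerivAt (fun y ↦ fderiv ℝ g y (E4.basisVector γ))
      ((fderiv ℝ (fderiv ℝ g) x).flip (E4.basisVector γ)) x := by
    have h1 : DifferentiableAt ℝ (fderiv ℝ g) x :=
      (hg.fderiv_right (m := 1) le_rfl).differentiableAt one_ne_zero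
    exact MetricCoord.hasFDerivAt_clm_apply_const h1.hasFDerivAt (E4.basisVector γ)
  exact (hL.clm_apply hw).congr_of_eventuallyEq heq

/-- `∂_α ∂_γ H^{μανβ}(x) = D²H(g x)(∂_α g, ∂_γ g) + DH(g x)(∂_α∂_γ g)` along a `C²` field
(`D²g(x)(∂_α, ∂_γ) = fderiv (fderiv g) x ∂_α ∂_γ`). [cite: LandauLifshitz1975, §96 (96.2)] -/
theorem fderiv_partialDeriv_superpotential_apply (hg : ContDiffAt ℝ 2 g x)
    (hx : metricDet g x ≠ 0) (δ γ μ α ν β : Fin 4) :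
    fderiv ℝ (fun y ↦ partialDeriv γ (fun z ↦ superpotential g z μ α ν β) y) x (E4.basisVector δ) =
      fderiv ℝ (fderiv ℝ (fun A : E4 →L[ℝ] E4 →L[ℝ] ℝ ↦ superpotential (fun _ : E4 ↦ A) 0 μ α ν β))
          (g x) (fderiv ℝ g x (E4.basisVector δ)) (fderiv ℝ g x (E4.basisVector γ)) +
        fderiv ℝ (fun A : E4 →L[ℝ] E4 →L[ℝ] ℝ ↦ superpotential (fun _ : E4 ↦ A) 0 μ α ν β) (g x)
          (fderiv ℝ (fderiv ℝ g) x (E4.basisVector δ) (E4.basisVector γ)) := by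
  rw [(hasFDerivAt_partialDeriv_superpotential hg hx γ μ α ν β).fderiv]
  simp only [_root_.add_apply, ContinuousLinearMap.coe_comp, Function.comp_apply,
    ContinuousLinearMap.flip_apply]
  ring

/-- **The Landau–Lifshitz energy–momentum complex along a `C²` field, through the value jets of
the superpotential**: `Σ_α ∂_α h^{μνα}(x) = (16π)⁻¹ Σ_{αβ} (D²H^{μβνα}(g x)(∂_αg, ∂_βg) +
DH^{μβνα}(g x)(∂_α∂_βg))`. [cite: LandauLifshitz1975, §96 (96.5)] -/
theorem emComplex_eq_sum_jet (hg : ContDiffAt ℝ 2 g x) (hx : metricDet g x ≠ 0) (μ ν : Fin 4) :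
    emComplex g x μ ν = (16 * Real.pi)⁻¹ * ∑ α : Fin 4, ∑ β : Fin 4,
      (fderiv ℝ (fderiv ℝ (fun A : E4 →L[ℝ] E4 →L[ℝ] ℝ ↦ superpotential (fun _ : E4 ↦ A) 0 μ β ν α))
          (g x) (fderiv ℝ g x (E4.basisVector α)) (fderiv ℝ g x (E4.basisVector β)) +
        fderiv ℝ (fun A : E4 →L[ℝ] E4 →L[ℝ] ℝ ↦ superpotential (fun _ : E4 ↦ A) 0 μ β ν α) (g x)
          (fderiv ℝ (fderiv ℝ g) x (E4.basisVector α) (E4.basisVector β))) := by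
  unfold emComplex
  rw [Finset.mul_sum]
  refine Finset.sum_congr rfl fun α _ ↦ ?_
  -- the derivative of `y ↦ h^{μνα}(y) = (16π)⁻¹ Σ_β ∂_β H^{μβνα}(y)` at `x`
  have h := fun β : Fin 4 ↦ hasFDerivAt_partialDeriv_superpotential hg hx β μ β ν α
  have hsum := (HasFDerivAt.fun_sum fun β (_ : β ∈ Finset.univ) ↦ h β).const_mul (16 * Real.pi)⁻¹
  have hfun : (fun y ↦ hField g y μ ν α) =
      fun y ↦ (16 * Real.pi)⁻¹ * ∑ β : Fin 4,
        partialDeriv β (fun z ↦ superpotential g z μ β ν α) y := by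
    funext y; rfl
  rw [partialDeriv, hfun, hsum.fderiv]
  simp only [_root_.smul_apply, _root_.sum_apply, _root_.add_apply, ContinuousLinearMap.coe_comp,
    Function.comp_apply, ContinuousLinearMap.flip_apply, smul_eq_mul, Finset.mul_sum]
  refine Finset.sum_congr rfl fun β _ ↦ ?_
  ring

end AlongField

end LandauLifshitz

end Literature.Geometry.Lorentzian
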